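import Mathlib
import Literature.Probability.Percolation.PercolationProofs
import Literature.Probability.LatticeModels.ProdBernoulliIndependence
import Literature.Probability.Percolation.KozmaNitzanPinning
import Summits.CriticalPhenomena.PercolationContinuityZ3.Theorems.PercNearOneGluingNoHeavyLowerTailFatMinorityOrderedAnchor
import HarnessLib

/-!
# `NoHeavyLowerTail` (stmt-CriticalPhenomena-4575), line fat-minority-linear — LINEAR GLUING WITH CONSTANT 1
# for one-layer observers from glued per-piece comparisons (Kozma–Nitzan's Question 9 at depth 2)

Route task `nh-dp-fatminority` (gen 5).  One-layer observer: `o ∉ A ∋ b`, every positive-weight neighbour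
`y` of `o` is a private unit (`y ∉ A`, positive pairs only to `o` and `A`); coins `w(o,x)` ARBITRARY.

* `oneLayer_orderedAnchor_pre` — let `a ∈ A`; suppose that for every set `B` of units there is an
  injective rank on `A` such that for each relay `c ∉ {a, b}` and each unit `x ∈ B` attachable to `c`
  the anchor is at most as likely to reach `b` as the block in ROW `B` with `c` GLUED to it:
  `μ_{B,c,x}(a ↔ b) ≤ μ_{B,c,x}(o ↔ b)`, where `μ_{B,c,x}` pins the coins of `B` open and the other coins
  closed, the attachments of `B` into earlier relays closed, `s(x,c)` open and `s(x',c)` (`x' < x`) closed.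
  Then `μ(o ↔ A, o ↮ b) ≤ μ(o ↔ A, a ↮ b)` — the pre-FKG inequality with anchor `a`, hence
  `bad := μ(o ↔ A, o ↮ b) ≤ μ(a ↮ b)`: LINEAR GLUING WITH `C = 1`, no `δ` term (`…_bad_le`).
* `oneLayer_orderedAnchor_family` — the same with a ROW-DEPENDENT anchor from a set `𝒜 ⊆ A`:
  `μ(o ↔ A, o ↮ b) ≤ ∑_{a ∈ 𝒜} μ(o ↔ A, a ↮ b)`, i.e. constant `|𝒜|` (numerically one anchor per row always
  admits a certified rank, but it is not always the same anchor: `FINDINGS-fat-minority-gen5.md` §8).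

Proof: the fired set `B` is the pattern of the coin cylinder; conditioning on it is pinning, and the
pinned weighting is a glued block on `B` (`orderedAnchor_glued`).  With `a = a† := argmin_{G∖o} μ(· ↔ b)`
some rank satisfied the hypothesis in every instance of the gen-5 census (`FINDINGS-fat-minority-gen5.md`
§1, §7); proving that such a rank always exists is the line's remaining residual for `C = 1` on the whole
one-layer class.  No new definitions.
-/


namespace Summit.CriticalPhenomena.PercolationContinuityZ3.Theorems

open MeasureTheory Set
open Literature.Probability.LatticeModels (prodBernoulli)
open Literature.Probability.Percolation (BondConfig openConn openGraph openGraph_adj)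
open scoped BigOperators

noncomputable section
open Classical
open Literature.Probability.LatticeModels Literature.Probability.Percolation

variable {n : ℕ}

/-- **Linear gluing with a FAMILY of anchors (row-dependent anchor).**  Setting of
`oneLayer_orderedAnchor_pre`, anchors `𝒜 ⊆ A`: if every fired set `B ⊆ X` admits SOME anchor `a ∈ 𝒜`
and some injective rank with the glued comparisons of row `B`, then
`μ(o ↔ A, o ↮ b) ≤ ∑_{a ∈ 𝒜} μ(o ↔ A, a ↮ b)` (`≤ |𝒜| · max_a μ(a ↮ b)`: linear gluing with constant `|𝒜|`).
[cite: KozmaNitzan2024, §3.2 Theorems 4–5 (p. 13) and Question 9 (p. 36)] -/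
theorem oneLayer_orderedAnchor_family (w : Sym2 (Fin n) → unitInterval) (A 𝒜 : Finset (Fin n)) (o b : Fin n)
    (hoA : o ∉ A) (hb : b ∈ A) (h𝒜 : 𝒜 ⊆ A)
    (hX : ∀ y : Fin n, y ≠ o → w s(o, y) ≠ 0 → y ∉ A ∧ ∀ z : Fin n, z ≠ o → z ∉ A → w s(y, z) = 0)
    (hEX : ∀ B : Finset (Fin n), B ⊆ (Finset.univ.filter fun y : Fin n => y ≠ o ∧ w s(o, y) ≠ 0) →
      ∃ a ∈ 𝒜, ∃ rk : Fin n → ℕ, Set.InjOn rk ↑A ∧ ∀ c ∈ A, c ≠ a → c ≠ b → ∀ x ∈ B, w s(x, c) ≠ 0 →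
        (prodBernoulli (pinW (pinW (pinW w
            (↑((Finset.univ.filter fun y : Fin n => y ≠ o ∧ w s(o, y) ≠ 0).image fun x => s(o, x)) :
              Set (Sym2 (Fin n))) (↑(B.image fun x => s(o, x)) : Set (Sym2 (Fin n))))
            (↑((B ×ˢ A.filter fun d => rk d < rk c).image fun p => s(p.1, p.2)) : Set (Sym2 (Fin n))) ∅)
            (↑(insert s(x, c) ((B.filter fun x' => x' < x).image fun x' => s(x', c))) : Set (Sym2 (Fin n)))
            {s(x, c)})).real (openConn a b) ≤
        (prodBernoulli (pinW (pinW (pinW w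
            (↑((Finset.univ.filter fun y : Fin n => y ≠ o ∧ w s(o, y) ≠ 0).image fun x => s(o, x)) :
              Set (Sym2 (Fin n))) (↑(B.image fun x => s(o, x)) : Set (Sym2 (Fin n))))
            (↑((B ×ˢ A.filter fun d => rk d < rk c).image fun p => s(p.1, p.2)) : Set (Sym2 (Fin n))) ∅)
            (↑(insert s(x, c) ((B.filter fun x' => x' < x).image fun x' => s(x', c))) : Set (Sym2 (Fin n)))
            {s(x, c)})).real (openConn o b)) :
    (prodBernoulli w).real ((⋃ c ∈ A, openConn o c) ∩ (openConn o b)ᶜ) ≤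
      ∑ a ∈ 𝒜, (prodBernoulli w).real ((⋃ c ∈ A, openConn o c) ∩ (openConn a b)ᶜ) := by
  set X : Finset (Fin n) := Finset.univ.filter fun y : Fin n => y ≠ o ∧ w s(o, y) ≠ 0 with hXdef
  set K : Finset (Sym2 (Fin n)) := X.image fun x => s(o, x) with hKdef
  have hmeas : ∀ E : Set (BondConfig (Fin n)), MeasurableSet E := fun _ => MeasurableSet.of_discrete
  -- an opaque copy of `univ` (keeps the decidability instances of the cylinder sum uniform)
  obtain ⟨Bu, hBu⟩ : ∃ Bu : Set (BondConfig (Fin n)), Bu = Set.univ := ⟨Set.univ, rfl⟩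
  have hdet : DeterminedBy Bu (↑K : Set (Sym2 (Fin n))) :=
    (determinedBy_iff _ _).2 fun _ _ _ => by simp [hBu]
  -- total probability over the coin patterns
  have hint : ∀ E : Set (BondConfig (Fin n)), E ∩ Bu = E := fun E => by rw [hBu, Set.inter_univ]
  have hrows : ∀ E : Set (BondConfig (Fin n)), (prodBernoulli w).real E =
      ∑ P ∈ K.powerset.filter (fun P : Finset (Sym2 (Fin n)) => (↑P : Set (Sym2 (Fin n))) ∈ Bu),
        (prodBernoulli w).real (localCylinder ↑K ↑P) * (prodBernoulli (pinW w ↑K ↑P)).real E := by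
    intro E
    have h := prodBernoulli_real_inter_eq_sum_pinW w K (hmeas E) hdet
    rwa [hint] at h
  rw [hrows, Finset.sum_congr rfl fun a _ => hrows ((⋃ c ∈ A, openConn o c) ∩ (openConn a b)ᶜ),
    Finset.sum_comm]
  refine Finset.sum_le_sum fun P hP => ?_
  rw [← Finset.mul_sum]
  have hPK : P ⊆ K := Finset.mem_powerset.1 (Finset.mem_filter.1 hP).1
  refine mul_le_mul_of_nonneg_left ?_ measureReal_nonneg
  -- the row `P`: a glued block on `B = {x ∈ X : s(o,x) ∈ P}`
  set B : Finset (Fin n) := X.filter fun x => s(o, x) ∈ P with hBdef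
  set wP := pinW w (↑K : Set (Sym2 (Fin n))) ↑P with hwP
  have hBX : B ⊆ X := Finset.filter_subset _ _
  have hXunit : ∀ x ∈ X, x ≠ o ∧ w s(o, x) ≠ 0 := fun x hx => (Finset.mem_filter.1 hx).2
  have hoX : o ∉ X := fun h => (hXunit o h).1 rfl
  have hoB : o ∉ B := fun h => hoX (hBX h)
  have hXA : Disjoint X A := by
    rw [Finset.disjoint_left]
    intro x hx
    exact (hX x (hXunit x hx).1 (hXunit x hx).2).1
  have hBA : Disjoint B A := hXA.mono_left hBX
  -- hypotheses of `orderedAnchor_pre` for `wP` and the block `B`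
  have hstar : ∀ x ∈ B, wP s(o, x) = 1 := by
    intro x hx
    obtain ⟨hxX, hxP⟩ := Finset.mem_filter.1 hx
    have hK : s(o, x) ∈ (↑K : Set (Sym2 (Fin n))) := Finset.mem_coe.2 (Finset.mem_image.2 ⟨x, hxX, rfl⟩)
    rw [hwP, pinW_apply_of_mem_of_mem w hK (Finset.mem_coe.2 hxP)]
  have hstar0 : ∀ y : Fin n, y ≠ o → y ∉ B → wP s(o, y) = 0 := by
    intro y hyo hyB
    by_cases hyX : y ∈ X
    · have hK : s(o, y) ∈ (↑K : Set (Sym2 (Fin n))) := Finset.mem_coe.2 (Finset.mem_image.2 ⟨y, hyX, rfl⟩)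
      have hP' : s(o, y) ∉ (↑P : Set (Sym2 (Fin n))) := fun h =>
        hyB (Finset.mem_filter.2 ⟨hyX, Finset.mem_coe.1 h⟩)
      rw [hwP, pinW_apply_of_mem_of_not_mem w hK hP']
    · have hw0 : w s(o, y) = 0 := by
        by_contra h
        exact hyX (Finset.mem_filter.2 ⟨Finset.mem_univ _, hyo, h⟩)
      have hK : s(o, y) ∉ (↑K : Set (Sym2 (Fin n))) := by
        intro h
        obtain ⟨x, hx, hxe⟩ := Finset.mem_image.1 (Finset.mem_coe.1 h)
        have hxo : x ≠ o := (hXunit x hx).1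
        rcases Sym2.eq_iff.1 hxe with ⟨_, h2⟩ | ⟨_, h2⟩
        · exact hyX (h2 ▸ hx)
        · exact hxo h2
      rw [hwP, pinW_apply_of_not_mem w _ hK, hw0]
  have hunit : ∀ x ∈ B, ∀ z : Fin n, z ≠ o → z ∉ A → wP s(x, z) = 0 := by
    intro x hx z hzo hzA
    have hxX := hBX hx
    have hxo : x ≠ o := (hXunit x hxX).1
    have hK : s(x, z) ∉ (↑K : Set (Sym2 (Fin n))) := by
      intro h
      obtain ⟨x', hx', hxe⟩ := Finset.mem_image.1 (Finset.mem_coe.1 h)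
      rcases Sym2.eq_iff.1 hxe with ⟨h1, _⟩ | ⟨h1, _⟩
      · exact hxo h1.symm
      · exact hzo h1.symm
    rw [hwP, pinW_apply_of_not_mem w _ hK]
    exact (hX x hxo (hXunit x hxX).2).2 z hzo hzA
  obtain ⟨a, ha𝒜, rk, hrk, hEXB⟩ := hEX B hBX
  have ha : a ∈ A := h𝒜 ha𝒜
  refine le_trans ?_ (Finset.single_le_sum (f := fun a' : Fin n =>
    (prodBernoulli (pinW w ↑K ↑P)).real ((⋃ c ∈ A, openConn o c) ∩ (openConn a' b)ᶜ))
    (fun _ _ => measureReal_nonneg) ha𝒜)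
  have hPeq : (B.image fun x => s(o, x)) = P := by
    ext e
    constructor
    · intro he
      obtain ⟨x, hx, rfl⟩ := Finset.mem_image.1 he
      exact (Finset.mem_filter.1 hx).2
    · intro he
      obtain ⟨x, hx, rfl⟩ := Finset.mem_image.1 (hPK he)
      exact Finset.mem_image.2 ⟨x, Finset.mem_filter.2 ⟨hx, he⟩, rfl⟩
  have hEX' : ∀ c ∈ A, c ≠ a → c ≠ b → ∀ x ∈ B, wP s(x, c) ≠ 0 →
      (prodBernoulli (pinW (pinW wP
          (↑((B ×ˢ A.filter fun d => rk d < rk c).image fun p => s(p.1, p.2)) : Set (Sym2 (Fin n))) ∅)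
          (↑(insert s(x, c) ((B.filter fun x' => x' < x).image fun x' => s(x', c))) : Set (Sym2 (Fin n)))
          {s(x, c)})).real (openConn a b) ≤
      (prodBernoulli (pinW (pinW wP
          (↑((B ×ˢ A.filter fun d => rk d < rk c).image fun p => s(p.1, p.2)) : Set (Sym2 (Fin n))) ∅)
          (↑(insert s(x, c) ((B.filter fun x' => x' < x).image fun x' => s(x', c))) : Set (Sym2 (Fin n)))
          {s(x, c)})).real (openConn o b) := by
    intro c hc hca hcb x hx hw
    have hxX := hBX hx
    have hxo : x ≠ o := (hXunit x hxX).1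
    have hco : c ≠ o := fun h => hoA (h ▸ hc)
    have hK : s(x, c) ∉ (↑K : Set (Sym2 (Fin n))) := by
      intro h
      obtain ⟨x', hx', hxe⟩ := Finset.mem_image.1 (Finset.mem_coe.1 h)
      rcases Sym2.eq_iff.1 hxe with ⟨h1, _⟩ | ⟨h1, _⟩
      · exact hxo h1.symm
      · exact hco h1.symm
    have hw' : w s(x, c) ≠ 0 := by rwa [hwP, pinW_apply_of_not_mem w _ hK] at hw
    have h := hEXB c hc hca hcb x hx hw'
    rw [hPeq] at h
    exact h
  exact orderedAnchor_glued wP B A o a b rk hrk hoB hoA hBA hb ha hstar hstar0 hunit hEX'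

/-- **Linear gluing with constant 1 for one-layer observers, from glued per-piece comparisons
(pre-FKG form).**  `o ∉ A ∋ b`, `a ∈ A`, every positive neighbour of `o` a private unit; with
`X = units`, `K = {s(o,x) : x ∈ X}` (coins): if for every `B ⊆ X` some injective rank `rk` on `A` gives,
for all `c ∈ A ∖ {a,b}` and `x ∈ B` with `w s(x,c) ≠ 0`, `μ_{B,c,x}(a ↔ b) ≤ μ_{B,c,x}(o ↔ b)` where
`μ_{B,c,x} = prodBernoulli (pinW (pinW (pinW w K (coins of B)) T ∅) F {s(x,c)})` (coins of `B` open,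
other coins closed; `T = {s(x',c') : x' ∈ B, rk c' < rk c}` closed; `F = {s(x,c)} ∪ {s(x',c) : x' < x}`
with `s(x,c)` open), then `μ(o ↔ A, o ↮ b) ≤ μ(o ↔ A, a ↮ b)`.
[cite: KozmaNitzan2024, §3.2 Theorems 4–5 (p. 13) and Question 9 (p. 36)] -/
theorem oneLayer_orderedAnchor_pre (w : Sym2 (Fin n) → unitInterval) (A : Finset (Fin n)) (o a b : Fin n)
    (hoA : o ∉ A) (hb : b ∈ A) (ha : a ∈ A)
    (hX : ∀ y : Fin n, y ≠ o → w s(o, y) ≠ 0 → y ∉ A ∧ ∀ z : Fin n, z ≠ o → z ∉ A → w s(y, z) = 0)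
    (hEX : ∀ B : Finset (Fin n), B ⊆ (Finset.univ.filter fun y : Fin n => y ≠ o ∧ w s(o, y) ≠ 0) →
      ∃ rk : Fin n → ℕ, Set.InjOn rk ↑A ∧ ∀ c ∈ A, c ≠ a → c ≠ b → ∀ x ∈ B, w s(x, c) ≠ 0 →
        (prodBernoulli (pinW (pinW (pinW w
            (↑((Finset.univ.filter fun y : Fin n => y ≠ o ∧ w s(o, y) ≠ 0).image fun x => s(o, x)) :
              Set (Sym2 (Fin n))) (↑(B.image fun x => s(o, x)) : Set (Sym2 (Fin n))))
            (↑((B ×ˢ A.filter fun d => rk d < rk c).image fun p => s(p.1, p.2)) : Set (Sym2 (Fin n))) ∅)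
            (↑(insert s(x, c) ((B.filter fun x' => x' < x).image fun x' => s(x', c))) : Set (Sym2 (Fin n)))
            {s(x, c)})).real (openConn a b) ≤
        (prodBernoulli (pinW (pinW (pinW w
            (↑((Finset.univ.filter fun y : Fin n => y ≠ o ∧ w s(o, y) ≠ 0).image fun x => s(o, x)) :
              Set (Sym2 (Fin n))) (↑(B.image fun x => s(o, x)) : Set (Sym2 (Fin n))))
            (↑((B ×ˢ A.filter fun d => rk d < rk c).image fun p => s(p.1, p.2)) : Set (Sym2 (Fin n))) ∅)
            (↑(insert s(x, c) ((B.filter fun x' => x' < x).image fun x' => s(x', c))) : Set (Sym2 (Fin n)))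
            {s(x, c)})).real (openConn o b)) :
    (prodBernoulli w).real ((⋃ c ∈ A, openConn o c) ∩ (openConn o b)ᶜ) ≤
      (prodBernoulli w).real ((⋃ c ∈ A, openConn o c) ∩ (openConn a b)ᶜ) := by
  rw [← Finset.sum_singleton (fun a' : Fin n =>
    (prodBernoulli w).real ((⋃ c ∈ A, openConn o c) ∩ (openConn a' b)ᶜ)) a]
  refine oneLayer_orderedAnchor_family w A {a} o b hoA hb (Finset.singleton_subset_iff.2 ha) hX ?_
  intro B hB
  obtain ⟨rk, hrk, h⟩ := hEX B hB
  exact ⟨a, Finset.mem_singleton_self a, rk, hrk, h⟩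

/-- **Linear gluing with constant 1 (bad form).**  Under the hypotheses of `oneLayer_orderedAnchor_pre`,
`μ(o ↔ A, o ↮ b) ≤ μ(a ↮ b)`; in particular `bad ≤ max_{a'∈A} μ(a' ↮ b)` with constant `1` and no
`μ(o ↮ A)` term. [cite: KozmaNitzan2024, §3.2 Theorem 5 (p. 13), Question 9 (p. 36)] -/
theorem oneLayer_orderedAnchor_bad_le (w : Sym2 (Fin n) → unitInterval) (A : Finset (Fin n)) (o a b : Fin n)
    (hoA : o ∉ A) (hb : b ∈ A) (ha : a ∈ A)
    (hX : ∀ y : Fin n, y ≠ o → w s(o, y) ≠ 0 → y ∉ A ∧ ∀ z : Fin n, z ≠ o → z ∉ A → w s(y, z) = 0)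
    (hEX : ∀ B : Finset (Fin n), B ⊆ (Finset.univ.filter fun y : Fin n => y ≠ o ∧ w s(o, y) ≠ 0) →
      ∃ rk : Fin n → ℕ, Set.InjOn rk ↑A ∧ ∀ c ∈ A, c ≠ a → c ≠ b → ∀ x ∈ B, w s(x, c) ≠ 0 →
        (prodBernoulli (pinW (pinW (pinW w
            (↑((Finset.univ.filter fun y : Fin n => y ≠ o ∧ w s(o, y) ≠ 0).image fun x => s(o, x)) :
              Set (Sym2 (Fin n))) (↑(B.image fun x => s(o, x)) : Set (Sym2 (Fin n))))
            (↑((B ×ˢ A.filter fun d => rk d < rk c).image fun p => s(p.1, p.2)) : Set (Sym2 (Fin n))) ∅)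
            (↑(insert s(x, c) ((B.filter fun x' => x' < x).image fun x' => s(x', c))) : Set (Sym2 (Fin n)))
            {s(x, c)})).real (openConn a b) ≤
        (prodBernoulli (pinW (pinW (pinW w
            (↑((Finset.univ.filter fun y : Fin n => y ≠ o ∧ w s(o, y) ≠ 0).image fun x => s(o, x)) :
              Set (Sym2 (Fin n))) (↑(B.image fun x => s(o, x)) : Set (Sym2 (Fin n))))
            (↑((B ×ˢ A.filter fun d => rk d < rk c).image fun p => s(p.1, p.2)) : Set (Sym2 (Fin n))) ∅)
            (↑(insert s(x, c) ((B.filter fun x' => x' < x).image fun x' => s(x', c))) : Set (Sym2 (Fin n)))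
            {s(x, c)})).real (openConn o b)) :
    (prodBernoulli w).real ((⋃ c ∈ A, openConn o c) ∩ (openConn o b)ᶜ) ≤
      (prodBernoulli w).real (openConn a b)ᶜ :=
  (oneLayer_orderedAnchor_pre w A o a b hoA hb ha hX hEX).trans
    (measureReal_mono Set.inter_subset_right (measure_ne_top _ _))

end

end Summit.CriticalPhenomena.PercolationContinuityZ3.Theorems
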